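import Mathlib
import Literature.Combinatorics.Optimization.FormulationRanks
import HarnessLib

/-!
# Nonnegativity problems: LP/SDP proofs, the factorization theorem and reductions; minimization problems
# (Braun–Pokutta–Roy 2016, §2.2–§2.3)

G. Braun, S. Pokutta, A. Roy, *Strong reductions for extended formulations* [BraunPokuttaRoy2016] (arXiv:1512.04932v3
numbering), §2.2 "Nonnegativity problems: Extended formulations as proof system" — "an abstract view of formulation
complexity, where the main idea is to reduce all statements to the core question about the complexity of deriving
nonnegativity for a class of nonnegative functions … with automatic availability of Yannakakis's Factorization Theorem and
the reduction mechanism": **Def. 2.16** (nonnegativity problem), **Def. 2.17** (LP proof / SDP proof of nonnegativity and the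
proof complexities `fc(𝒫)`, `fc_SDP(𝒫)`), **Def. 2.18** (slack matrix `M_𝒫 = val`; LP/SDP factorizations — in
`FormulationRanks.lean`), **Thm. 2.20** (`fc(𝒫) = rk_LP M_𝒫`, `fc_SDP(𝒫) = rk_SDP M_𝒫`), **Def. 2.21** (reduction:
`val_{𝔍₁}(s₁) = val_{𝔍₁*}(s₁*)·M₁ + M₂`), **Thm. 2.22** (`fc(𝒫₁) ≤ rk_LP M₂ + rk_LP M₁ + rk_+ M₁·fc(𝒫₂)` and the SDP
analogue); §2.2.4/§2.3: an optimization problem with guarantees `(C, S)` is the nonnegativity problem `𝒫_{C,S}` on the sound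
instances with `val = τ(C − val)`, whence Def. 2.23–2.25 and **Thm. 2.26** for maximization AND minimization problems.

Everything TYPED verbatim and PROVED (no named facts):
* `NonnegProblem`, `NonnegProblem.LPProof`, `NonnegProblem.SDPProof` (Def. 2.16–2.17; `val ≥ 0` is forced:
  `LPProof.val_nonneg`, `SDPProof.val_nonneg`).
* **Thm. 2.20 exactly**: `LPProof.hasLPFactorization` (Farkas, `Literature.Analysis.Convex.LPDuality.affine_farkas`),
  `LPProof.ofLPFactorization`, `LPProof.nonempty_iff_hasLPFactorization`; `SDPProof.hasSDPFactorization` (conic duality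
  imported from the TREE THEOREM `SDPFormulation.exists_posSemidef_slack` through the encoding `toMax` = "`−val ≤ 0`"),
  `SDPProof.ofSDPFactorization`, `SDPProof.nonempty_iff_hasSDPFactorization`.
* The rank algebra of the proof of Thm. 2.22: `HasLPFactorization.submatrix/add/hadamard`,
  `HasSDPFactorization.submatrix/add/hadamard` (`rk_LP(A∘B) ≤ rk_LP A·rk_+ B + rk_LP B` etc.).
* `NonnegProblem.Reduction` (Def. 2.21) and **Thm. 2.22 exactly** in both currencies: `Reduction.hasLPFactorization`,
  `Reduction.nonempty_lpProof`, `Reduction.hasSDPFactorization`, `Reduction.nonempty_sdpProof`.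
* `MaxProblem.toNonneg` (`𝒫_{C,S}`, `toNonneg_val = slackMatrix`), `LPFormulation.toLPProof` / `LPProof.toLPFormulation`,
  `SDPFormulation.toSDPProof` / `SDPProof.toSDPFormulation'` (Thm. 2.26 as the special case of Thm. 2.20).
* **Minimization problems**: `MinProblem` (`Sound` = `min val ≥ S`), `MinProblem.slackMatrix` (`val − C`, Def. 2.25 with
  `τ = −1`), `MinProblem.toNonneg`, `MinLPFormulation` / `MinSDPFormulation` (Def. 2.23–2.24, guarantee `w_𝔍(x) ≥ C(𝔍)`),
  the conversions to/from proofs of `𝒫_{C,S}`, and **Thm. 2.26 (min) exactly**: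
  `MinLPFormulation.nonempty_iff_hasLPFactorization`, `MinSDPFormulation.nonempty_iff_hasSDPFactorization`, plus the `nnr`
  lower-bound form `MinLPFormulation.isEmpty_of_not_hasNonnegFactorization`.
-/

noncomputable section

open Finset Matrix
open scoped MatrixOrder

namespace Literature.Combinatorics.Optimization

open Literature.Analysis.Convex (LPDuality.affine_farkas)

variable {σ φ : Type*}

/-! ### Def. 2.16–2.18: nonnegativity problems, LP and SDP proofs, slack matrix -/

/-- **Def. 2.16 (nonnegativity problem)** `𝒫 = (𝒮, 𝔍, val)`: instances, feasible solutions and an evaluation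
`val : 𝔍 × 𝒮 → ℝ` whose nonnegativity is to be proved (the printed definition takes `val ≥ 0`; an LP or SDP proof forces
it, `LPProof.val_nonneg` / `SDPProof.val_nonneg`).  Its slack matrix (Def. 2.18) is `val` itself.
[cite: BraunPokuttaRoy2016, Def. 2.16 and Def. 2.18 (arXiv v3)] -/
structure NonnegProblem (σ : Type*) (φ : Type*) where
  /-- the evaluation `val_𝔍(s)` -/
  val : φ → σ → ℝ

namespace NonnegProblem

/-- **Def. 2.17 (LP proof of nonnegativity, size `R`)**: a linear program `A x ≤ b` with `R` inequalities containing vectors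
`x^s`, affine `w_𝔍` exact on the `x^s` (`w_𝔍(x^s) = val_𝔍(s)`), and "Proof: `w_𝔍(x) ≥ 0` whenever `A x ≤ b`".
[cite: BraunPokuttaRoy2016, Def. 2.17 (arXiv v3)] -/
structure LPProof (P : NonnegProblem σ φ) (R : ℕ) where
  /-- number of variables -/
  D : ℕ
  /-- constraint matrix -/
  A : Matrix (Fin R) (Fin D) ℝ
  /-- right-hand side -/
  b : Fin R → ℝ
  /-- the vectors `x^s` -/
  x : σ → Fin D → ℝ
  /-- `A x^s ≤ b` -/
  mem : ∀ s i, (A *ᵥ x s) i ≤ b i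
  /-- linear part of `w_𝔍` -/
  w : φ → Fin D → ℝ
  /-- constant part of `w_𝔍` -/
  c : φ → ℝ
  /-- exactness `w_𝔍(x^s) = val_𝔍(s)` -/
  exact : ∀ f s, w f ⬝ᵥ x s + c f = P.val f s
  /-- the proof: `A x ≤ b ⇒ w_𝔍(x) ≥ 0` -/
  proof : ∀ f (y : Fin D → ℝ), (∀ i, (A *ᵥ y) i ≤ b i) → 0 ≤ w f ⬝ᵥ y + c f

/-- **Def. 2.17 (SDP proof of nonnegativity, size `d`)**: a semidefinite program `{X ∈ 𝕊^d_+ : 𝒜(X) = b}` containing psd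
`X^s`, affine `w_𝔍` exact on the `X^s`, and `w_𝔍(X) ≥ 0` on the spectrahedron. [cite: BraunPokuttaRoy2016, Def. 2.17 (arXiv v3)] -/
structure SDPProof (P : NonnegProblem σ φ) (d : ℕ) where
  /-- number of equality constraints -/
  k : ℕ
  /-- the linear map `𝒜` -/
  A : Matrix (Fin d) (Fin d) ℝ →ₗ[ℝ] (Fin k → ℝ)
  /-- right-hand side -/
  b : Fin k → ℝ
  /-- the psd matrices `X^s` -/
  X : σ → Matrix (Fin d) (Fin d) ℝ
  posSemidef_X : ∀ s, (X s).PosSemidef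
  A_X : ∀ s, A (X s) = b
  /-- linear part of `w_𝔍` -/
  w : φ → Matrix (Fin d) (Fin d) ℝ →ₗ[ℝ] ℝ
  /-- constant part of `w_𝔍` -/
  c : φ → ℝ
  exact : ∀ f s, w f (X s) + c f = P.val f s
  proof : ∀ f (Y : Matrix (Fin d) (Fin d) ℝ), Y.PosSemidef → A Y = b → 0 ≤ w f Y + c f

variable {P : NonnegProblem σ φ} {R d : ℕ}

/-- An LP proof proves nonnegativity. [cite: BraunPokuttaRoy2016, Def. 2.16–2.17 (arXiv v3)] -/
theorem LPProof.val_nonneg (E : LPProof P R) (f : φ) (s : σ) : 0 ≤ P.val f s := by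
  rw [← E.exact f s]; exact E.proof f (E.x s) (E.mem s)

/-- An SDP proof proves nonnegativity. [cite: BraunPokuttaRoy2016, Def. 2.16–2.17 (arXiv v3)] -/
theorem SDPProof.val_nonneg (E : SDPProof P d) (f : φ) (s : σ) : 0 ≤ P.val f s := by
  rw [← E.exact f s]; exact E.proof f (E.X s) (E.posSemidef_X s) (E.A_X s)

/-! ### Thm. 2.20: `fc(𝒫) = rk_LP M_𝒫` and `fc_SDP(𝒫) = rk_SDP M_𝒫`, exactly -/

/-- **Thm. 2.20, LP, `rk_LP M_𝒫 ≤ fc(𝒫)`**: "By Farkas's lemma, there are nonnegative `u_𝔍` and nonnegative numbers `γ_𝔍`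
with `w_𝔍(x) = u_𝔍·(b − Ax) + γ_𝔍`.  Substituting `x` by `x^s` …". [cite: BraunPokuttaRoy2016, Thm. 2.20 (arXiv v3)] -/
theorem LPProof.hasLPFactorization (E : LPProof P R) : HasLPFactorization P.val R := by
  classical
  rcases isEmpty_or_nonempty σ with hσ | ⟨⟨s₀⟩⟩
  · exact ⟨fun _ _ => 0, fun _ s => isEmptyElim s, fun _ => 0, fun _ _ => le_rfl, fun _ s => isEmptyElim s,
      fun _ => le_rfl, fun _ s => isEmptyElim s⟩
  have hP : ∃ y : Fin E.D → ℝ, E.A *ᵥ y ≤ E.b := ⟨E.x s₀, fun i => E.mem s₀ i⟩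
  have hfar : ∀ f : φ, ∃ u : Fin R → ℝ, 0 ≤ u ∧ u ᵥ* E.A = -E.w f ∧ u ⬝ᵥ E.b ≤ E.c f := fun f =>
    LPDuality.affine_farkas E.A E.b (-E.w f) hP fun y hy => by
      have := E.proof f y (fun i => hy i); rw [neg_dotProduct]; linarith
  choose u hu huA hub using hfar
  refine ⟨u, fun i s => E.b i - (E.A *ᵥ E.x s) i, fun f => E.c f - u f ⬝ᵥ E.b, fun f l => hu f l,
    fun i s => by linarith [E.mem s i], fun f => by linarith [hub f], fun f s => ?_⟩
  have hws : E.w f ⬝ᵥ E.x s = -(u f ⬝ᵥ (E.A *ᵥ E.x s)) := by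
    rw [Matrix.dotProduct_mulVec, huA f, neg_dotProduct, neg_neg]
  have hex := E.exact f s
  have hsum : ∑ i : Fin R, u f i * (E.b i - (E.A *ᵥ E.x s) i) = u f ⬝ᵥ E.b - u f ⬝ᵥ (E.A *ᵥ E.x s) := by
    simp only [dotProduct, mul_sub, sum_sub_distrib]
  rw [hsum]
  linarith

/-- **Thm. 2.20, LP, `fc(𝒫) ≤ rk_LP M_𝒫`**: "The linear program is `x ≥ 0` … `s` is represented by `x^s` … `w_𝔍(x) := u_𝔍 x +
γ_𝔍`". [cite: BraunPokuttaRoy2016, Thm. 2.20 (arXiv v3)] -/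
def LPProof.ofLPFactorization (P : NonnegProblem σ φ) {r : ℕ} (U : φ → Fin r → ℝ) (V : Fin r → σ → ℝ) (u : φ → ℝ)
    (hU : ∀ f l, 0 ≤ U f l) (hV : ∀ l s, 0 ≤ V l s) (hu : ∀ f, 0 ≤ u f)
    (hM : ∀ f s, P.val f s = ∑ l, U f l * V l s + u f) : LPProof P r where
  D := r
  A := -1
  b := 0
  x s l := V l s
  mem s i := by simp [Matrix.neg_mulVec, hV i s]
  w := U
  c := u
  exact f s := by rw [hM f s]; rfl
  proof f y hy := by
    have hy' : ∀ l, 0 ≤ y l := fun l => by have := hy l; simpa [Matrix.neg_mulVec] using this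
    exact add_nonneg (sum_nonneg fun l _ => mul_nonneg (hU _ _) (hy' l)) (hu f)

/-- **Thm. 2.20, LP clause, exactly**: `fc(𝒫) = rk_LP M_𝒫`. [cite: BraunPokuttaRoy2016, Thm. 2.20 (arXiv v3)] -/
theorem LPProof.nonempty_iff_hasLPFactorization (P : NonnegProblem σ φ) :
    Nonempty (LPProof P R) ↔ HasLPFactorization P.val R := by
  constructor
  · rintro ⟨E⟩; exact E.hasLPFactorization
  · rintro ⟨U, V, u, hU, hV, hu, hM⟩; exact ⟨LPProof.ofLPFactorization P U V u hU hV hu hM⟩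

/-- The maximization problem "`−val ≤ 0`" (`C = S = 0`) encoding a nonnegativity problem, used to import conic duality
from the tree's SDP factorization theorem. [cite: BraunPokuttaRoy2016, §2.2.4 (`𝒫_{C,S}`), read backwards (arXiv v3)] -/
def toMax (P : NonnegProblem σ φ) : MaxProblem σ φ where
  val f s := -P.val f s
  C _ := 0
  S _ := 0

/-- Soundness in `toMax` is nonnegativity. [cite: BraunPokuttaRoy2016, §2.2.4 (arXiv v3)] -/
theorem toMax_sound_iff (P : NonnegProblem σ φ) (f : φ) : P.toMax.Sound f ↔ ∀ s, 0 ≤ P.val f s := by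
  simp [MaxProblem.Sound, toMax]

/-- An SDP proof of `𝒫` is an SDP formulation of `toMax 𝒫`. [cite: BraunPokuttaRoy2016, Def. 2.17 / Def. 2.24 (arXiv v3)] -/
def SDPProof.toSDPFormulation (E : SDPProof P d) : SDPFormulation P.toMax d where
  k := E.k
  A := E.A
  b := E.b
  X := E.X
  posSemidef_X := E.posSemidef_X
  A_X := E.A_X
  w f := -E.w f
  c f := -E.c f
  exact f _ s := by simp only [LinearMap.neg_apply, toMax]; linarith [E.exact f s]
  achieves f _ Y hY hAY := by simp only [LinearMap.neg_apply, toMax]; linarith [E.proof f Y hY hAY]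

/-- **Thm. 2.20, SDP, `rk_SDP M_𝒫 ≤ fc_SDP(𝒫)`** (conic duality: the tree theorem `SDPFormulation.exists_posSemidef_slack`
applied to `toMax 𝒫`). [cite: BraunPokuttaRoy2016, Thm. 2.20 (arXiv v3)] -/
theorem SDPProof.hasSDPFactorization (E : SDPProof P d) : HasSDPFactorization P.val d := by
  classical
  have hsd : ∀ f, P.toMax.Sound f := fun f => (P.toMax_sound_iff f).2 (E.val_nonneg f)
  choose U hU μ hμ hslack using fun f : φ => E.toSDPFormulation.exists_posSemidef_slack (hsd f)
  refine ⟨U, E.X, μ, hU, E.posSemidef_X, hμ, fun f s => ?_⟩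
  have := hslack f s
  simp only [toMax, sub_neg_eq_add, zero_add] at this
  exact this

/-- `Y ↦ Tr[G Y]`. [folklore] -/
private def trL {r : ℕ} (G : Matrix (Fin r) (Fin r) ℝ) : Matrix (Fin r) (Fin r) ℝ →ₗ[ℝ] ℝ where
  toFun Y := (G * Y).trace
  map_add' Y Z := by simp only [Matrix.mul_add, trace_add]
  map_smul' a Y := by simp only [Matrix.mul_smul, trace_smul, smul_eq_mul, RingHom.id_apply]

/-- Unfolding. [folklore] -/
@[simp] private theorem trL_apply {r : ℕ} (G Y : Matrix (Fin r) (Fin r) ℝ) : trL G Y = (G * Y).trace := rfl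

/-- `Tr[A B] ≥ 0` for psd `A, B`. [folklore] -/
private theorem tr_mul_nonneg {r : ℕ} {A B : Matrix (Fin r) (Fin r) ℝ} (hA : A.PosSemidef) (hB : B.PosSemidef) :
    0 ≤ (A * B).trace := by
  set S : Matrix (Fin r) (Fin r) ℝ := CFC.sqrt A with hS
  have hSpsd : S.PosSemidef := (CFC.sqrt_nonneg A).posSemidef
  have hSS : S * S = A := CFC.sqrt_mul_sqrt_self A hA.nonneg
  have hSH : Sᴴ = S := hSpsd.1
  have hM : (S * B * Sᴴ).PosSemidef := hB.mul_mul_conjTranspose_same S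
  have htrM : (S * B * Sᴴ).trace = (A * B).trace := by
    rw [hSH, Matrix.mul_assoc, trace_mul_comm, Matrix.mul_assoc, hSS, trace_mul_comm]
  rw [← htrM]
  exact hM.trace_nonneg

/-- **Thm. 2.20, SDP, `fc_SDP(𝒫) ≤ rk_SDP M_𝒫`**: the SDP is the whole cone, `X^s = B_s`, `w_𝔍(Y) = Tr[A_𝔍 Y] + u_𝔍`.
[cite: BraunPokuttaRoy2016, Thm. 2.20 (arXiv v3)] -/
def SDPProof.ofSDPFactorization (P : NonnegProblem σ φ) {r : ℕ} (A : φ → Matrix (Fin r) (Fin r) ℝ)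
    (B : σ → Matrix (Fin r) (Fin r) ℝ) (u : φ → ℝ) (hA : ∀ f, (A f).PosSemidef) (hB : ∀ s, (B s).PosSemidef)
    (hu : ∀ f, 0 ≤ u f) (hM : ∀ f s, P.val f s = (A f * B s).trace + u f) : SDPProof P r where
  k := 0
  A := 0
  b := 0
  X := B
  posSemidef_X := hB
  A_X s := Subsingleton.elim _ _
  w f := trL (A f)
  c := u
  exact f s := by rw [trL_apply, hM f s]
  proof f Y hY _ := by rw [trL_apply]; exact add_nonneg (tr_mul_nonneg (hA f) hY) (hu f)

/-- **Thm. 2.20, SDP clause, exactly**: `fc_SDP(𝒫) = rk_SDP M_𝒫`. [cite: BraunPokuttaRoy2016, Thm. 2.20 (arXiv v3)] -/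
theorem SDPProof.nonempty_iff_hasSDPFactorization (P : NonnegProblem σ φ) :
    Nonempty (SDPProof P d) ↔ HasSDPFactorization P.val d := by
  constructor
  · rintro ⟨E⟩; exact E.hasSDPFactorization
  · rintro ⟨A, B, u, hA, hB, hu, hM⟩; exact ⟨SDPProof.ofSDPFactorization P A B u hA hB hu hM⟩

end NonnegProblem

/-! ### Algebra of LP / SDP factorizations (the identities used in the proof of Thm. 2.22) -/

namespace HasLPFactorization

variable {ι κ : Type*}

/-- Pull-back along maps. [cite: BraunPokuttaRoy2016, proof of Thm. 2.22 (arXiv v3)] -/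
theorem submatrix {ι' κ' : Type*} {M : ι → κ → ℝ} {r : ℕ} (h : HasLPFactorization M r) (f : ι' → ι) (g : κ' → κ) :
    HasLPFactorization (fun i j => M (f i) (g j)) r := by
  obtain ⟨U, V, u, hU, hV, hu, hM⟩ := h
  exact ⟨fun i => U (f i), fun l j => V l (g j), fun i => u (f i), fun _ _ => hU _ _, fun _ _ => hV _ _, fun _ => hu _,
    fun i j => hM _ _⟩

/-- `rk_LP(A + B) ≤ rk_LP A + rk_LP B`. [cite: BraunPokuttaRoy2016, proof of Thm. 2.22 (arXiv v3)] -/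
theorem add {A B : ι → κ → ℝ} {r s : ℕ} (hA : HasLPFactorization A r) (hB : HasLPFactorization B s) :
    HasLPFactorization (fun i j => A i j + B i j) (r + s) := by
  obtain ⟨U, V, u, hU, hV, hu, hA⟩ := hA
  obtain ⟨U', V', u', hU', hV', hu', hB⟩ := hB
  have hN : HasNonnegFactorization (fun i j => ∑ l, U i l * V l j) r := ⟨U, V, hU, hV, fun _ _ => rfl⟩
  have hN' : HasNonnegFactorization (fun i j => ∑ l, U' i l * V' l j) s := ⟨U', V', hU', hV', fun _ _ => rfl⟩
  obtain ⟨U'', V'', hU'', hV'', hM''⟩ := hN.add hN'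
  refine ⟨U'', V'', fun i => u i + u' i, hU'', hV'', fun i => add_nonneg (hu i) (hu' i), fun i j => ?_⟩
  have h'' := hM'' i j
  beta_reduce at h''
  beta_reduce
  rw [hA i j, hB i j, ← h'']; ring

/-- `rk_LP(A ∘ B) ≤ rk_LP A · rk_+ B + rk_LP B` for the Hadamard product with a matrix `B` having both kinds of
factorization (`(ΣUV + u𝟙) ∘ B = (ΣUV) ∘ B + u𝟙 ∘ B`). [cite: BraunPokuttaRoy2016, proof of Thm. 2.22 (arXiv v3)] -/
theorem hadamard {A B : ι → κ → ℝ} {r n r₁ : ℕ} (hA : HasLPFactorization A r) (hBn : HasNonnegFactorization B n)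
    (hBl : HasLPFactorization B r₁) : HasLPFactorization (fun i j => A i j * B i j) (r * n + r₁) := by
  obtain ⟨U, V, u, hU, hV, hu, hA⟩ := hA
  have hN : HasNonnegFactorization (fun i j => ∑ l, U i l * V l j) r := ⟨U, V, hU, hV, fun _ _ => rfl⟩
  have h1 : HasNonnegFactorization (fun i j => (∑ l, U i l * V l j) * B i j) (r * n) := hN.hadamard hBn
  obtain ⟨U', V', u', hU', hV', hu', hB⟩ := hBl
  have h2 : HasLPFactorization (fun i j => u i * B i j) r₁ := by
    refine ⟨fun i l => u i * U' i l, V', fun i => u i * u' i, fun i l => mul_nonneg (hu i) (hU' i l), hV',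
      fun i => mul_nonneg (hu i) (hu' i), fun i j => ?_⟩
    beta_reduce
    rw [hB i j, mul_add, mul_sum]
    exact congrArg₂ (· + ·) (sum_congr rfl fun l _ => by ring) rfl
  obtain ⟨U'', V'', u'', hU'', hV'', hu'', hM''⟩ := h1.hasLPFactorization.add h2
  refine ⟨U'', V'', u'', hU'', hV'', hu'', fun i j => ?_⟩
  have h'' := hM'' i j
  beta_reduce at h''
  beta_reduce
  rw [← h'', hA i j]; ring

end HasLPFactorization

namespace HasSDPFactorization

variable {ι κ : Type*}

/-- Pull-back along maps. [cite: BraunPokuttaRoy2016, proof of Thm. 2.22 (arXiv v3)] -/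
theorem submatrix {ι' κ' : Type*} {M : ι → κ → ℝ} {r : ℕ} (h : HasSDPFactorization M r) (f : ι' → ι) (g : κ' → κ) :
    HasSDPFactorization (fun i j => M (f i) (g j)) r := by
  obtain ⟨A, B, u, hA, hB, hu, hM⟩ := h
  exact ⟨fun i => A (f i), fun j => B (g j), fun i => u (f i), fun _ => hA _, fun _ => hB _, fun _ => hu _,
    fun i j => hM _ _⟩

/-- `rk_SDP(A + B) ≤ rk_SDP A + rk_SDP B`. [cite: BraunPokuttaRoy2016, proof of Thm. 2.22 (arXiv v3)] -/
theorem add {A B : ι → κ → ℝ} {r s : ℕ} (hA : HasSDPFactorization A r) (hB : HasSDPFactorization B s) :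
    HasSDPFactorization (fun i j => A i j + B i j) (r + s) := by
  obtain ⟨A₁, B₁, u, hA₁, hB₁, hu, hA⟩ := hA
  obtain ⟨A₂, B₂, u', hA₂, hB₂, hu', hB⟩ := hB
  have hP₁ : HasPsdFactorization (fun i j => (A₁ i * B₁ j).trace) r := ⟨A₁, B₁, hA₁, hB₁, fun _ _ => rfl⟩
  have hP₂ : HasPsdFactorization (fun i j => (A₂ i * B₂ j).trace) s := ⟨A₂, B₂, hA₂, hB₂, fun _ _ => rfl⟩
  obtain ⟨A₃, B₃, hA₃, hB₃, hM₃⟩ := hP₁.add hP₂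
  refine ⟨A₃, B₃, fun i => u i + u' i, hA₃, hB₃, fun i => add_nonneg (hu i) (hu' i), fun i j => ?_⟩
  have h₃ := hM₃ i j
  beta_reduce at h₃
  beta_reduce
  rw [hA i j, hB i j, ← h₃]; ring

/-- `rk_SDP(A ∘ B) ≤ rk_SDP A · rk_psd B + rk_SDP B`. [cite: BraunPokuttaRoy2016, proof of Thm. 2.22 (arXiv v3)] -/
theorem hadamard {A B : ι → κ → ℝ} {r n r₁ : ℕ} (hA : HasSDPFactorization A r) (hBn : HasPsdFactorization B n)
    (hBl : HasSDPFactorization B r₁) : HasSDPFactorization (fun i j => A i j * B i j) (r * n + r₁) := by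
  obtain ⟨A₁, B₁, u, hA₁, hB₁, hu, hA⟩ := hA
  have hP₁ : HasPsdFactorization (fun i j => (A₁ i * B₁ j).trace) r := ⟨A₁, B₁, hA₁, hB₁, fun _ _ => rfl⟩
  have h1 : HasPsdFactorization (fun i j => (A₁ i * B₁ j).trace * B i j) (r * n) := hP₁.hadamard hBn
  obtain ⟨A₂, B₂, u', hA₂, hB₂, hu', hB⟩ := hBl
  have h2 : HasSDPFactorization (fun i j => u i * B i j) r₁ := by
    refine ⟨fun i => u i • A₂ i, B₂, fun i => u i * u' i, fun i => (hA₂ i).smul (hu i), hB₂,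
      fun i => mul_nonneg (hu i) (hu' i), fun i j => ?_⟩
    beta_reduce
    rw [hB i j, Matrix.smul_mul, trace_smul, smul_eq_mul]; ring
  obtain ⟨A₃, B₃, u'', hA₃, hB₃, hu'', hM₃⟩ := h1.hasSDPFactorization.add h2
  refine ⟨A₃, B₃, u'', hA₃, hB₃, hu'', fun i j => ?_⟩
  have h₃ := hM₃ i j
  beta_reduce at h₃
  beta_reduce
  rw [← h₃, hA i j]; ring

end HasSDPFactorization

/-! ### Def. 2.21 / Thm. 2.22: reductions between nonnegativity problems -/

namespace NonnegProblem

variable {σ₁ φ₁ σ₂ φ₂ : Type*}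

/-- **Def. 2.21 (reduction between nonnegativity problems)**: maps `*` on instances and solutions and two nonnegative
`𝔍₁ × 𝒮₁` matrices `M₁, M₂` with `val_{𝔍₁}(s₁) = val_{𝔍₁*}(s₁*)·M₁(𝔍₁, s₁) + M₂(𝔍₁, s₁)`.
[cite: BraunPokuttaRoy2016, Def. 2.21 (arXiv v3)] -/
structure Reduction (P₁ : NonnegProblem σ₁ φ₁) (P₂ : NonnegProblem σ₂ φ₂) where
  /-- `* : 𝔍₁ → 𝔍₂` -/
  inst : φ₁ → φ₂
  /-- `* : 𝒮₁ → 𝒮₂` -/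
  sol : σ₁ → σ₂
  /-- `M₁` -/
  M₁ : φ₁ → σ₁ → ℝ
  /-- `M₂` -/
  M₂ : φ₁ → σ₁ → ℝ
  M₁_nonneg : ∀ f s, 0 ≤ M₁ f s
  M₂_nonneg : ∀ f s, 0 ≤ M₂ f s
  /-- `val₁ = (val₂ ∘ *)·M₁ + M₂` -/
  val_eq : ∀ f s, P₁.val f s = P₂.val (inst f) (sol s) * M₁ f s + M₂ f s

variable {P₁ : NonnegProblem σ₁ φ₁} {P₂ : NonnegProblem σ₂ φ₂}

/-- **Thm. 2.22, LP clause, exactly**: `rk_LP M_{𝒫₁} ≤ rk_LP M₂ + rk_LP M₁ + rk_+ M₁ · rk_LP M_{𝒫₂}`, i.e. with Thm. 2.20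
`fc(𝒫₁) ≤ rk_LP M₂ + rk_LP M₁ + rk_+ M₁ · fc(𝒫₂)`. [cite: BraunPokuttaRoy2016, Thm. 2.22 (arXiv v3)] -/
theorem Reduction.hasLPFactorization (R : Reduction P₁ P₂) {r n₁ r₁ r₂ : ℕ} (h₂ : HasLPFactorization P₂.val r)
    (hn₁ : HasNonnegFactorization R.M₁ n₁) (hl₁ : HasLPFactorization R.M₁ r₁) (hl₂ : HasLPFactorization R.M₂ r₂) :
    HasLPFactorization P₁.val (r * n₁ + r₁ + r₂) := by
  have h := ((h₂.submatrix R.inst R.sol).hadamard hn₁ hl₁).add hl₂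
  obtain ⟨U, V, u, hU, hV, hu, hM⟩ := h
  exact ⟨U, V, u, hU, hV, hu, fun f s => by rw [R.val_eq f s]; exact hM f s⟩

/-- **Thm. 2.22 at proof level (LP)**: an LP proof for `𝒫₂` of size `r` and the three auxiliary factorizations give an LP
proof for `𝒫₁` of size `r·rk_+M₁ + rk_LP M₁ + rk_LP M₂`. [cite: BraunPokuttaRoy2016, Thm. 2.22 (arXiv v3)] -/
theorem Reduction.nonempty_lpProof (R : Reduction P₁ P₂) {r n₁ r₁ r₂ : ℕ} (E : LPProof P₂ r)
    (hn₁ : HasNonnegFactorization R.M₁ n₁) (hl₁ : HasLPFactorization R.M₁ r₁) (hl₂ : HasLPFactorization R.M₂ r₂) :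
    Nonempty (LPProof P₁ (r * n₁ + r₁ + r₂)) :=
  (LPProof.nonempty_iff_hasLPFactorization P₁).2 (R.hasLPFactorization E.hasLPFactorization hn₁ hl₁ hl₂)

/-- **Thm. 2.22, SDP clause, exactly**: `rk_SDP M_{𝒫₁} ≤ rk_SDP M₂ + rk_SDP M₁ + rk_psd M₁ · rk_SDP M_{𝒫₂}`.
[cite: BraunPokuttaRoy2016, Thm. 2.22 (arXiv v3)] -/
theorem Reduction.hasSDPFactorization (R : Reduction P₁ P₂) {r n₁ r₁ r₂ : ℕ} (h₂ : HasSDPFactorization P₂.val r)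
    (hn₁ : HasPsdFactorization R.M₁ n₁) (hl₁ : HasSDPFactorization R.M₁ r₁) (hl₂ : HasSDPFactorization R.M₂ r₂) :
    HasSDPFactorization P₁.val (r * n₁ + r₁ + r₂) := by
  have h := ((h₂.submatrix R.inst R.sol).hadamard hn₁ hl₁).add hl₂
  obtain ⟨A, B, u, hA, hB, hu, hM⟩ := h
  exact ⟨A, B, u, hA, hB, hu, fun f s => by rw [R.val_eq f s]; exact hM f s⟩

/-- **Thm. 2.22 at proof level (SDP)**. [cite: BraunPokuttaRoy2016, Thm. 2.22 (arXiv v3)] -/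
theorem Reduction.nonempty_sdpProof (R : Reduction P₁ P₂) {r n₁ r₁ r₂ : ℕ} (E : SDPProof P₂ r)
    (hn₁ : HasPsdFactorization R.M₁ n₁) (hl₁ : HasSDPFactorization R.M₁ r₁) (hl₂ : HasSDPFactorization R.M₂ r₂) :
    Nonempty (SDPProof P₁ (r * n₁ + r₁ + r₂)) :=
  (SDPProof.nonempty_iff_hasSDPFactorization P₁).2 (R.hasSDPFactorization E.hasSDPFactorization hn₁ hl₁ hl₂)

end NonnegProblem

/-! ### §2.2.4 / Def. 2.25: optimization problems as nonnegativity problems `𝒫_{C,S}` -/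

/-- The nonnegativity problem `𝒫_{C,S}` of a maximization problem: instances the sound ones, `val = C(𝔍) − val_𝔍(s)` —
its slack matrix is `M_{𝒫,C,S}` (Def. 2.25, `τ = +1`). [cite: BraunPokuttaRoy2016, §2.2.4 and Def. 2.25 (arXiv v3)] -/
def MaxProblem.toNonneg (P : MaxProblem σ φ) : NonnegProblem σ {f : φ // P.Sound f} where
  val f s := P.C f.1 - P.val f.1 s

/-- `M_{𝒫_{C,S}} = M_{𝒫,C,S}`. [cite: BraunPokuttaRoy2016, Def. 2.25 (arXiv v3)] -/
@[simp] theorem MaxProblem.toNonneg_val (P : MaxProblem σ φ) : P.toNonneg.val = P.slackMatrix := rfl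

variable {R d : ℕ}

/-- A `(C,S)`-approximate LP formulation (Def. 2.23) is an LP proof for `𝒫_{C,S}` (`w ↦ C − w`).
[cite: BraunPokuttaRoy2016, §2.3, "Theorem 2.26 … as a special case of Theorem 2.20" (arXiv v3)] -/
def LPFormulation.toLPProof {P : MaxProblem σ φ} (E : LPFormulation P R) : P.toNonneg.LPProof R where
  D := E.D
  A := E.A
  b := E.b
  x := E.x
  mem := E.mem
  w f := -E.w f.1
  c f := P.C f.1 - E.c f.1
  exact f s := by simp only [neg_dotProduct, MaxProblem.toNonneg]; linarith [E.exact f.1 f.2 s]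
  proof f y hy := by simp only [neg_dotProduct]; linarith [E.achieves f.1 f.2 y hy]

/-- Conversely an LP proof for `𝒫_{C,S}` is a `(C,S)`-approximate LP formulation (unsound instances unconstrained).
[cite: BraunPokuttaRoy2016, §2.3 (arXiv v3)] -/
def NonnegProblem.LPProof.toLPFormulation {P : MaxProblem σ φ} (E : P.toNonneg.LPProof R) : LPFormulation P R := by
  classical
  exact
  { D := E.D
    A := E.A
    b := E.b
    x := E.x
    mem := E.mem
    w := fun f => if h : P.Sound f then -E.w ⟨f, h⟩ else 0
    c := fun f => if h : P.Sound f then P.C f - E.c ⟨f, h⟩ else 0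
    exact := fun f hf s => by
      have := E.exact ⟨f, hf⟩ s
      simp only [MaxProblem.toNonneg] at this
      simp only [dif_pos hf, neg_dotProduct]; linarith
    achieves := fun f hf y hy => by
      have := E.proof ⟨f, hf⟩ y hy
      simp only [dif_pos hf, neg_dotProduct]; linarith }

/-- The same for SDP formulations (Def. 2.24). [cite: BraunPokuttaRoy2016, §2.3 (arXiv v3)] -/
def SDPFormulation.toSDPProof {P : MaxProblem σ φ} (E : SDPFormulation P d) : P.toNonneg.SDPProof d where
  k := E.k
  A := E.A
  b := E.b
  X := E.X
  posSemidef_X := E.posSemidef_X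
  A_X := E.A_X
  w f := -E.w f.1
  c f := P.C f.1 - E.c f.1
  exact f s := by simp only [LinearMap.neg_apply, MaxProblem.toNonneg]; linarith [E.exact f.1 f.2 s]
  proof f Y hY hAY := by simp only [LinearMap.neg_apply]; linarith [E.achieves f.1 f.2 Y hY hAY]

/-- And back. [cite: BraunPokuttaRoy2016, §2.3 (arXiv v3)] -/
def NonnegProblem.SDPProof.toSDPFormulation' {P : MaxProblem σ φ} (E : P.toNonneg.SDPProof d) : SDPFormulation P d := by
  classical
  exact
  { k := E.k
    A := E.A
    b := E.b
    X := E.X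
    posSemidef_X := E.posSemidef_X
    A_X := E.A_X
    w := fun f => if h : P.Sound f then -E.w ⟨f, h⟩ else 0
    c := fun f => if h : P.Sound f then P.C f - E.c ⟨f, h⟩ else 0
    exact := fun f hf s => by
      have := E.exact ⟨f, hf⟩ s
      simp only [MaxProblem.toNonneg] at this
      simp only [dif_pos hf, LinearMap.neg_apply]; linarith
    achieves := fun f hf Y hY hAY => by
      have := E.proof ⟨f, hf⟩ Y hY hAY
      simp only [dif_pos hf, LinearMap.neg_apply]; linarith }

/-! ### Minimization problems (Def. 2.23–2.25 with `τ = −1`) and their factorization theorem -/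

/-- A **minimization problem** with guarantees `C` (completeness) and `S` (soundness).
[cite: BraunPokuttaRoy2016, §2.1 and Def. 2.23 (arXiv v3)] -/
structure MinProblem (σ : Type*) (φ : Type*) where
  /-- objective values `val_𝔍(s)` -/
  val : φ → σ → ℝ
  /-- completeness guarantee -/
  C : φ → ℝ
  /-- soundness guarantee -/
  S : φ → ℝ

namespace MinProblem

/-- Sound instances of a minimization problem: `𝔍^S = {𝔍 : min val_𝔍 ≥ S(𝔍)}` ("`τ OPT(𝔍) ≤ τ S(𝔍)`", `τ = −1`).
[cite: BraunPokuttaRoy2016, Def. 2.23 (arXiv v3)] -/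
def Sound (P : MinProblem σ φ) (f : φ) : Prop := ∀ s, P.S f ≤ P.val f s

/-- **Def. 2.25 (`τ = −1`)**: the `(C,S)`-approximate slack matrix of a minimization problem, `M(𝔍, s) = val_𝔍(s) − C(𝔍)` on
sound `𝔍`. [cite: BraunPokuttaRoy2016, Def. 2.25 (arXiv v3)] -/
def slackMatrix (P : MinProblem σ φ) : {f : φ // P.Sound f} → σ → ℝ := fun f s => P.val f.1 s - P.C f.1

/-- Unfolding. [cite: BraunPokuttaRoy2016, Def. 2.25 (arXiv v3)] -/
@[simp] theorem slackMatrix_apply (P : MinProblem σ φ) (f : {f : φ // P.Sound f}) (s : σ) :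
    P.slackMatrix f s = P.val f.1 s - P.C f.1 := rfl

/-- The nonnegativity problem `𝒫_{C,S}` of a minimization problem (`val = val_𝔍(s) − C(𝔍)` on sound instances).
[cite: BraunPokuttaRoy2016, §2.2.4 and Def. 2.25 (arXiv v3)] -/
def toNonneg (P : MinProblem σ φ) : NonnegProblem σ {f : φ // P.Sound f} where
  val f s := P.val f.1 s - P.C f.1

/-- `M_{𝒫_{C,S}} = M_{𝒫,C,S}`. [cite: BraunPokuttaRoy2016, Def. 2.25 (arXiv v3)] -/
@[simp] theorem toNonneg_val (P : MinProblem σ φ) : P.toNonneg.val = P.slackMatrix := rfl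

end MinProblem

/-- **Def. 2.23 for a minimization problem (`(C,S)`-approximate LP formulation of size `R`)**: as for maximization, with
the guarantee "`A x ≤ b ⇒ w_𝔍(x) ≥ C(𝔍)`" for sound `𝔍`. [cite: BraunPokuttaRoy2016, Def. 2.23 (arXiv v3)] -/
structure MinLPFormulation (P : MinProblem σ φ) (R : ℕ) where
  /-- number of variables -/
  D : ℕ
  /-- constraint matrix -/
  A : Matrix (Fin R) (Fin D) ℝ
  /-- right-hand side -/
  b : Fin R → ℝ
  /-- the vectors `x^s` -/
  x : σ → Fin D → ℝ
  mem : ∀ s i, (A *ᵥ x s) i ≤ b i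
  /-- linear part of `w_𝔍` -/
  w : φ → Fin D → ℝ
  /-- constant part of `w_𝔍` -/
  c : φ → ℝ
  exact : ∀ f, P.Sound f → ∀ s, w f ⬝ᵥ x s + c f = P.val f s
  achieves : ∀ f, P.Sound f → ∀ y : Fin D → ℝ, (∀ i, (A *ᵥ y) i ≤ b i) → P.C f ≤ w f ⬝ᵥ y + c f

/-- **Def. 2.24 for a minimization problem (`(C,S)`-approximate SDP formulation of size `d`)**.
[cite: BraunPokuttaRoy2016, Def. 2.24 (arXiv v3)] -/
structure MinSDPFormulation (P : MinProblem σ φ) (d : ℕ) where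
  /-- number of equality constraints -/
  k : ℕ
  A : Matrix (Fin d) (Fin d) ℝ →ₗ[ℝ] (Fin k → ℝ)
  b : Fin k → ℝ
  X : σ → Matrix (Fin d) (Fin d) ℝ
  posSemidef_X : ∀ s, (X s).PosSemidef
  A_X : ∀ s, A (X s) = b
  w : φ → Matrix (Fin d) (Fin d) ℝ →ₗ[ℝ] ℝ
  c : φ → ℝ
  exact : ∀ f, P.Sound f → ∀ s, w f (X s) + c f = P.val f s
  achieves : ∀ f, P.Sound f → ∀ Y : Matrix (Fin d) (Fin d) ℝ, Y.PosSemidef → A Y = b → P.C f ≤ w f Y + c f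

/-- A min LP formulation is an LP proof for `𝒫_{C,S}` (`w ↦ w − C`). [cite: BraunPokuttaRoy2016, §2.3 (arXiv v3)] -/
def MinLPFormulation.toLPProof {P : MinProblem σ φ} (E : MinLPFormulation P R) : P.toNonneg.LPProof R where
  D := E.D
  A := E.A
  b := E.b
  x := E.x
  mem := E.mem
  w f := E.w f.1
  c f := E.c f.1 - P.C f.1
  exact f s := by simp only [MinProblem.toNonneg]; linarith [E.exact f.1 f.2 s]
  proof f y hy := by linarith [E.achieves f.1 f.2 y hy]

/-- And back. [cite: BraunPokuttaRoy2016, §2.3 (arXiv v3)] -/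
def NonnegProblem.LPProof.toMinLPFormulation {P : MinProblem σ φ} (E : P.toNonneg.LPProof R) :
    MinLPFormulation P R := by
  classical
  exact
  { D := E.D
    A := E.A
    b := E.b
    x := E.x
    mem := E.mem
    w := fun f => if h : P.Sound f then E.w ⟨f, h⟩ else 0
    c := fun f => if h : P.Sound f then E.c ⟨f, h⟩ + P.C f else 0
    exact := fun f hf s => by
      have := E.exact ⟨f, hf⟩ s
      simp only [MinProblem.toNonneg] at this
      simp only [dif_pos hf]; linarith
    achieves := fun f hf y hy => by
      have := E.proof ⟨f, hf⟩ y hy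
      simp only [dif_pos hf]; linarith }

/-- **Thm. 2.26 for minimization problems, LP clause, exactly**: `fc(𝒫, C, S) = rk_LP M_{𝒫,C,S}`.
[cite: BraunPokuttaRoy2016, Thm. 2.26 (arXiv v3)] -/
theorem MinLPFormulation.nonempty_iff_hasLPFactorization (P : MinProblem σ φ) :
    Nonempty (MinLPFormulation P R) ↔ HasLPFactorization P.slackMatrix R := by
  rw [← MinProblem.toNonneg_val, ← NonnegProblem.LPProof.nonempty_iff_hasLPFactorization]
  exact ⟨fun ⟨E⟩ => ⟨E.toLPProof⟩, fun ⟨E⟩ => ⟨E.toMinLPFormulation⟩⟩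

/-- A min SDP formulation is an SDP proof for `𝒫_{C,S}`. [cite: BraunPokuttaRoy2016, §2.3 (arXiv v3)] -/
def MinSDPFormulation.toSDPProof {P : MinProblem σ φ} (E : MinSDPFormulation P d) : P.toNonneg.SDPProof d where
  k := E.k
  A := E.A
  b := E.b
  X := E.X
  posSemidef_X := E.posSemidef_X
  A_X := E.A_X
  w f := E.w f.1
  c f := E.c f.1 - P.C f.1
  exact f s := by simp only [MinProblem.toNonneg]; linarith [E.exact f.1 f.2 s]
  proof f Y hY hAY := by linarith [E.achieves f.1 f.2 Y hY hAY]

/-- And back. [cite: BraunPokuttaRoy2016, §2.3 (arXiv v3)] -/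
def NonnegProblem.SDPProof.toMinSDPFormulation {P : MinProblem σ φ} (E : P.toNonneg.SDPProof d) :
    MinSDPFormulation P d := by
  classical
  exact
  { k := E.k
    A := E.A
    b := E.b
    X := E.X
    posSemidef_X := E.posSemidef_X
    A_X := E.A_X
    w := fun f => if h : P.Sound f then E.w ⟨f, h⟩ else 0
    c := fun f => if h : P.Sound f then E.c ⟨f, h⟩ + P.C f else 0
    exact := fun f hf s => by
      have := E.exact ⟨f, hf⟩ s
      simp only [MinProblem.toNonneg] at this
      simp only [dif_pos hf]; linarith
    achieves := fun f hf Y hY hAY => by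
      have := E.proof ⟨f, hf⟩ Y hY hAY
      simp only [dif_pos hf]; linarith }

/-- **Thm. 2.26 for minimization problems, SDP clause, exactly**: `fc_SDP(𝒫, C, S) = rk_SDP M_{𝒫,C,S}`.
[cite: BraunPokuttaRoy2016, Thm. 2.26 (arXiv v3)] -/
theorem MinSDPFormulation.nonempty_iff_hasSDPFactorization (P : MinProblem σ φ) :
    Nonempty (MinSDPFormulation P d) ↔ HasSDPFactorization P.slackMatrix d := by
  rw [← MinProblem.toNonneg_val, ← NonnegProblem.SDPProof.nonempty_iff_hasSDPFactorization]
  exact ⟨fun ⟨E⟩ => ⟨E.toSDPProof⟩, fun ⟨E⟩ => ⟨E.toMinSDPFormulation⟩⟩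

/-- Lower bounds for minimization problems in `nnr` currency (Remark 2.19): no nonnegative factorization of `M_{𝒫,C,S}` of
size `R + 1` ⇒ no LP formulation of size `R`. [cite: BraunPokuttaRoy2016, Thm. 2.26 with Rem. 2.19 (arXiv v3)] -/
theorem MinLPFormulation.isEmpty_of_not_hasNonnegFactorization {P : MinProblem σ φ}
    (h : ¬ HasNonnegFactorization P.slackMatrix (R + 1)) : IsEmpty (MinLPFormulation P R) :=
  ⟨fun E => h ((MinLPFormulation.nonempty_iff_hasLPFactorization P).1 ⟨E⟩).hasNonnegFactorization⟩

end Literature.Combinatorics.Optimization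

end
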